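import Literature.AlgebraicGeometry.ComplexMultiplication.EndomorphismFieldSignatureTraceCondition
import Literature.AlgebraicGeometry.Motives.AbelianVarietyLieAlgebra
import HarnessLib

/-!
# The signature conditions LITERALLY «acting on `Lie(A)`» and for EVERY `a ∈ F`: the rational action
# `lieAction ∘ ι` of `F` on `Lie(A) = (𝔪_e/𝔪_e²)^*` is diagonal with characters `Φ`

Topic `Literature/AlgebraicGeometry/ComplexMultiplication` (family `hodge`, lane `lit-hodgefound`; the ALGEBRAIC
carrier `Motives.AbelianVariety ℂ`, Shimura's pairs `(A, ι : F →+* A.endAlgebra)`, `[F : ℚ] = 2 dim A`, THE type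
`Φ = cmTypeOfPair ι hF`).  The files `EndomorphismFieldCotangentEigenforms`, `…SignatureCondition` (g26-#3),
`…SignatureTraceCondition` (g26-#8), `…DeterminantCondition` (g26-#10) state every determinant / trace /
signature condition on the COTANGENT space `𝔇₀(A) = 𝔪_e/𝔪_e²` and for GENUINE endomorphisms `u` with
`1 ⊗ u = ι(α)` (an `α` of the order `ι⁻¹(End A)`).  The sources speak of `Lie(A)` and of every `x ∈ 𝒪_K`; the
tree's RATIONAL action `Motives.AbelianVariety.lieAction A : End⁰(A) →ₐ[ℚ] End_ℂ(Lie A)` (file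
`Motives/AbelianVarietyLieAlgebra`: `q ⊗ u ↦ q · Lie(u)`, `Lie(u) = (u^*)ᵗ`) lets us state them VERBATIM, for every
`a ∈ F`, with no lift: this file does so.

PRINTED STATEMENTS.  S. Kudla, M. Rapoport [KudlaRapoport2013] §2.1 (2.1): «`char(T, ι(a) | Lie A) =
(T − a)^{n−r} (T − a^σ)^r`, `a ∈ 𝒪_k`».  B. Howard [Howard2012] §1: «for any `x ∈ 𝒪_{K₀}`, locally on `S` the
determinant of `T − x` acting on `Lie(A)` is equal to the image of `(T − ι(x))^r (T − ῑ(x))^s`», §3.1: «every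
`x ∈ 𝒪_K` acts on `Lie(A)` with characteristic polynomial `∏_{φ ∈ Φ} (T − φ(x))`».  G. Shimura [Shimura1998]
§5.2 p. 39 («`δι(α)ωᵢ = α^{φᵢ}ωᵢ` … the `ωᵢ` form a basis of `𝔇₀(A)`»; the representation of `F` on the tangent
space is `⊕_{φ ∈ Φ} φ`), §3.2 (the representation of `End(A) ⊗ ℚ`, «`S` is the transpose of the representation
of `δλ`»), §8.3 Prop. 29 (the type norm `det`).  R. Kottwitz [Kottwitz1992] §5 p. 390.

WHAT IS PROVED (hypotheses `(ιF : F →+* A.endAlgebra) (hF : finrank ℚ F = 2 * A.dim)`, `K₀ : IntermediateField ℚ F`,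
`m_ψ = Fintype.card {σ : Φ.1 // σ|_{K₀} = ψ}`; `L(a) = Motives.AbelianVariety.lieAction A (ιF a) ∈ End_ℂ(Lie A)`):

* §1 **`exists_basis_lieAction_eq_smul`** — an eigenbasis of `Lie(A)` indexed by `Φ` for ALL of `ι(F)`:
  `L(a) ω*_φ = φ(a) ω*_φ` for every `a ∈ F` (the dual basis of the eigenforms; `ι(a) = M⁻¹ (1 ⊗ u)`);
  `exists_basis_toMatrix_lieAction_eq_diagonal`.
* §2 for every `a ∈ F`: **`charpoly_lieAction_eq_prod`** (`char(ι(a) | Lie A) = ∏_{φ ∈ Φ} (X − φ(a))`, Howard §3.1),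
  `det_lieAction_eq_prod` (the type norm), `trace_lieAction_eq_sum` (the type trace).
* §3 over `K₀`: `charpoly_lieAction_eq_prod_pow`; `K₀` imaginary quadratic: **`charpoly_lieAction_eq_pow_mul_pow`** —
  KUDLA–RAPOPORT (2.1) / HOWARD'S `(r, s)`-SIGNATURE CONDITION VERBATIM with `(r, s) = (m_ψ, m_ψ̄)`, for every
  `a ∈ K₀`; `trace_lieAction_eq_card_mul_add_card_mul`; **`forall_charpoly_lieAction_eq_iff_card_fibre_eq`**,
  `forall_charpoly_lieAction_eq_iff_forall_charpoly_cotangentMap_eq` (≡ the lifted cotangent formulation of g26-#3),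
  `forall_trace_lieAction_eq_iff_card_fibre_eq`.
* §4 **`hodgeConjectureFor_powSucc_of_forall_charpoly_lieAction_eq`** — the complex points of `𝓜_{(1, n−1)}` =
  `𝓜_{(n−1, 1)}` (conjugate) with complex multiplication by `F ⊇ K₀`, `n ≥ 3`, satisfy the Hodge conjecture with all
  their powers; `isSimple_of_forall_charpoly_lieAction_eq`.

Theorems only; no definition, no named fact, no `sorry` (net debt 0); axioms `propext`, `Classical.choice`,
`Quot.sound`.

## References
* [KudlaRapoport2013] S. Kudla, M. Rapoport, J. reine angew. Math. 697 (2014), §2.1 (2.1).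
* [Howard2012] B. Howard, Ann. of Math. (2) 176 (2012), §1, §3.1 (Def. 3.1.1).
* [Shimura1998] G. Shimura, *Abelian Varieties with Complex Multiplication and Modular Functions* (1998), §3.2, §5.2
  p. 39, §8.3 Prop. 29, §8.4 (1).
* [Kottwitz1992] R. E. Kottwitz, J. Amer. Math. Soc. 5 (1992), §5, p. 390.
* [Gordon1999HodgeAVSurvey] B. B. Gordon (1999), Thm. 6.4, §9.3.  [Dodson1984] B. Dodson, Trans. AMS 283 (1984), §3.1.1.
* [GortzWedhorn2023] U. Görtz, T. Wedhorn, *Algebraic Geometry II* (2023), Rem. 27.18 (`Lie = (𝔪_e/𝔪_e²)^*`).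

## Provenance

Lane `lit-hodgefound` (HOME `run/shared/lean/pub/lit-hodgefound/`), prover seat `lit-hodgefound-p11` (gen 26),
self-proposed row g26-#11 (INBOX claim 2026-08-27).
-/

noncomputable section

namespace Literature.AlgebraicGeometry.ComplexMultiplication

open scoped Manifold Classical nonZeroDivisors Polynomial
open CategoryTheory NumberField Module Polynomial
open Literature.AlgebraicGeometry.Motives
open Literature.AlgebraicGeometry.HodgeTheory
open Literature.NumberTheory.ComplexMultiplication

namespace EndFieldFullDegree

variable {F : Type} [Field F] [NumberField F] {A : AbelianVariety ℂ}
  (ιF : F →+* A.endAlgebra) (hF : finrank ℚ F = 2 * A.dim) (K₀ : IntermediateField ℚ F)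

/-! ### §1 The dual basis of the eigenforms is an eigenbasis of `Lie(A)` for all of `ι(F)` -/

omit [NumberField F] in
/-- `ι(a) = M⁻¹ · (1 ⊗ u)` from `1 ⊗ u = ι(M a)`, `M ≠ 0`. [folklore] -/
private theorem eq_algebraMap_inv_mul_of {a : F} {M : ℕ} {u : End A} (hM : M ≠ 0)
    (hu : AbelianVariety.endAlgebra.of A u = ιF ((M : F) * a)) :
    ιF a = algebraMap ℚ A.endAlgebra (M : ℚ)⁻¹ * AbelianVariety.endAlgebra.of A u := by
  rw [hu, map_mul, map_natCast, ← mul_assoc, ← map_natCast (algebraMap ℚ A.endAlgebra) M, ← map_mul,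
    inv_mul_cancel₀ (Nat.cast_ne_zero.2 hM : (M : ℚ) ≠ 0), map_one, one_mul]

/-- **An eigenbasis of `Lie(A)` for the whole field `ι(F)`**: there is a basis `(ω*_φ)_{φ ∈ Φ}` of
`Lie(A) = (𝔪_e/𝔪_e²)^*` with `ι(a) · ω*_φ = φ(a) ω*_φ` for EVERY `a ∈ F` (the dual basis of Shimura's eigenforms
`ω_φ`, «`δι(α)ωᵢ = α^{φᵢ}ωᵢ`»; for `a ∉ ι⁻¹(End A)` through `ι(a) = M⁻¹(1 ⊗ u)` and the rational action
`q ⊗ u ↦ q · Lie(u)`). [cite: Shimura1998, §5.2, p. 39; §3.2] [cite: GortzWedhorn2023, Rem. 27.18 (1) (p. 805)] -/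
theorem exists_basis_lieAction_eq_smul :
    ∃ b : Basis (cmTypeOfPair ιF hF).1 ℂ (Motives.AbelianVariety.Lie A),
      ∀ (σ : (cmTypeOfPair ιF hF).1) (a : F),
        Motives.AbelianVariety.lieAction A (ιF a) (b σ) = (σ.1 a : ℂ) • b σ := by
  obtain ⟨b, hb⟩ := exists_basis_eigenforms ιF hF
  refine ⟨b.dualBasis, fun σ a => ?_⟩
  obtain ⟨M, u, hM, hu⟩ := exists_of_eq_natCast_mul ιF a
  have hdual : Motives.AbelianVariety.lieMap A u (b.dualBasis σ) = (σ.1 ((M : F) * a) : ℂ) • b.dualBasis σ := by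
    refine b.ext fun τ => ?_
    rw [Motives.AbelianVariety.lieMap_apply, hb τ ((M : F) * a) u hu, map_smul, LinearMap.smul_apply,
      Basis.dualBasis_apply_self, smul_eq_mul, smul_eq_mul]
    by_cases h : τ = σ
    · subst h
      simp
    · rw [if_neg h, mul_zero, mul_zero]
  rw [Motives.AbelianVariety.lieAction_of_eq_algebraMap_mul_of (eq_algebraMap_inv_mul_of ιF hM hu),
    LinearMap.smul_apply, hdual, smul_smul, map_mul, map_natCast,
    inv_mul_cancel_left₀ (Nat.cast_ne_zero.2 hM : (M : ℂ) ≠ 0)]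

/-- **`ι(a)` on `Lie(A)` is `diag(φ(a))_{φ ∈ Φ}`** for every `a ∈ F`. [cite: Shimura1998, §5.2, p. 39; §3.2] -/
theorem exists_basis_toMatrix_lieAction_eq_diagonal :
    ∃ b : Basis (cmTypeOfPair ιF hF).1 ℂ (Motives.AbelianVariety.Lie A),
      ∀ a : F, LinearMap.toMatrix b b (Motives.AbelianVariety.lieAction A (ιF a)) =
        Matrix.diagonal fun σ : (cmTypeOfPair ιF hF).1 => (σ.1 a : ℂ) := by
  obtain ⟨b, hb⟩ := exists_basis_lieAction_eq_smul ιF hF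
  refine ⟨b, fun a => ?_⟩
  ext i j
  rw [LinearMap.toMatrix_apply, hb j a, map_smul, Finsupp.smul_apply, b.repr_self, Matrix.diagonal_apply,
    Finsupp.single_apply, smul_eq_mul, mul_ite, mul_one, mul_zero]
  by_cases h : i = j
  · subst h
    simp
  · rw [if_neg (Ne.symm h), if_neg h]

/-! ### §2 `char`, `det`, `tr` of `ι(a)` on `Lie(A)`, for every `a ∈ F` -/

/-- **«every `x ∈ 𝒪_K` acts on `Lie(A)` with characteristic polynomial `∏_{φ ∈ Φ} (T − φ(x))`»** — and so does
every `a ∈ F` through the rational action. [cite: Howard2012, §3.1 (display after Def. 3.1.1)] [cite: Shimura1998, §5.2, p. 39] -/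
theorem charpoly_lieAction_eq_prod (a : F) :
    (Motives.AbelianVariety.lieAction A (ιF a)).charpoly = ∏ σ : (cmTypeOfPair ιF hF).1, (X - C (σ.1 a : ℂ)) := by
  obtain ⟨b, hb⟩ := exists_basis_toMatrix_lieAction_eq_diagonal ιF hF
  rw [← LinearMap.charpoly_toMatrix _ b, hb, Matrix.charpoly_diagonal]

/-- **`det(ι(a) | Lie A) = ∏_{φ ∈ Φ} φ(a)`** (the type norm) for every `a ∈ F`. [cite: Shimura1998, §8.3 Prop. 29 (p. 63); §5.2, p. 39] -/
theorem det_lieAction_eq_prod (a : F) :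
    LinearMap.det (Motives.AbelianVariety.lieAction A (ιF a)) = ∏ σ : (cmTypeOfPair ιF hF).1, (σ.1 a : ℂ) := by
  obtain ⟨b, hb⟩ := exists_basis_toMatrix_lieAction_eq_diagonal ιF hF
  rw [← LinearMap.det_toMatrix b, hb, Matrix.det_diagonal]

/-- **`tr(ι(a) | Lie A) = ∑_{φ ∈ Φ} φ(a)`** (the type trace) for every `a ∈ F`. [cite: Shimura1998, §5.2, p. 39; §3.2 (pp. 19–20)] -/
theorem trace_lieAction_eq_sum (a : F) :
    LinearMap.trace ℂ _ (Motives.AbelianVariety.lieAction A (ιF a)) = ∑ σ : (cmTypeOfPair ιF hF).1, (σ.1 a : ℂ) := by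
  obtain ⟨b, hb⟩ := exists_basis_toMatrix_lieAction_eq_diagonal ιF hF
  rw [LinearMap.trace_eq_matrix_trace ℂ b, hb, Matrix.trace_diagonal]

/-! ### §3 Over a subfield `K₀ ⊆ F`: the `(r, s)`-signature condition verbatim -/

/-- `char(ι(a) | Lie A) = ∏_ψ (X − ψ(a))^{m_ψ}` for `a ∈ K₀`. [cite: Howard2012, §1 and §3.1] [cite: Kottwitz1992, §5 (p. 390)] -/
theorem charpoly_lieAction_eq_prod_pow (a : K₀) :
    (Motives.AbelianVariety.lieAction A (ιF (algebraMap K₀ F a))).charpoly =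
      ∏ ψ : K₀ →+* ℂ, (X - C (ψ a : ℂ)) ^
        Fintype.card {σ : (cmTypeOfPair ιF hF).1 // σ.1.comp (algebraMap K₀ F) = ψ} := by
  rw [charpoly_lieAction_eq_prod ιF hF]
  have h := Fintype.prod_fiberwise' (fun σ : (cmTypeOfPair ιF hF).1 ↦ σ.1.comp (algebraMap K₀ F))
    (fun ψ : K₀ →+* ℂ ↦ (X - C (ψ a : ℂ)))
  simp only [RingHom.comp_apply] at h
  rw [← h]
  refine Finset.prod_congr rfl fun ψ _ ↦ ?_
  rw [Finset.prod_const, Finset.card_univ]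

omit [NumberField F] in
/-- The cotangent statements for a genuine endomorphism are the `Lie(A)` statements for `1 ⊗ u`:
`char(δu | 𝔪_e/𝔪_e²) = char(ι(a) | Lie A)` when `1 ⊗ u = ι(a)`. [cite: Shimura1998, §3.2] -/
theorem charpoly_cotangentMap_eq_charpoly_lieAction {α : F} {u : End A}
    (hu : AbelianVariety.endAlgebra.of A u = ιF α) :
    (Motives.AbelianVariety.cotangentMap A u).charpoly = (Motives.AbelianVariety.lieAction A (ιF α)).charpoly := by
  rw [← Motives.AbelianVariety.charpoly_lieMap, ← Motives.AbelianVariety.lieAction_of, hu]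

omit [NumberField F] in
/-- … and `tr(δu | 𝔪_e/𝔪_e²) = tr(ι(a) | Lie A)`. [cite: Shimura1998, §3.2] -/
theorem trace_cotangentMap_eq_trace_lieAction {α : F} {u : End A}
    (hu : AbelianVariety.endAlgebra.of A u = ιF α) :
    LinearMap.trace ℂ _ (Motives.AbelianVariety.cotangentMap A u) =
      LinearMap.trace ℂ _ (Motives.AbelianVariety.lieAction A (ιF α)) := by
  rw [← Motives.AbelianVariety.trace_lieMap, ← Motives.AbelianVariety.lieAction_of, hu]

section Quadratic

variable [IsTotallyComplex K₀]

/-- `ψ̄ ≠ ψ`. [folklore] -/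
private theorem conjugate_ne₁₁ (ψ : K₀ →+* ℂ) : ComplexEmbedding.conjugate ψ ≠ ψ := fun h =>
  IsTotallyComplex.complexEmbedding_not_isReal ψ (ComplexEmbedding.isReal_iff.2 h)

/-- `Hom(K₀, ℂ) = {ψ, ψ̄}` for `[K₀ : ℚ] = 2`. [cite: Shimura1998, §8.4 (1)] -/
private theorem univ_eq_pair₁₁ (hK₀ : finrank ℚ K₀ = 2) (ψ : K₀ →+* ℂ) :
    (Finset.univ : Finset (K₀ →+* ℂ)) = {ψ, ComplexEmbedding.conjugate ψ} := by
  ext χ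
  simp only [Finset.mem_univ, Finset.mem_insert, Finset.mem_singleton, true_iff]
  by_contra h
  push Not at h
  have h3 := Fintype.two_lt_card_iff.2 ⟨χ, ψ, ComplexEmbedding.conjugate ψ, h.1, h.2, (conjugate_ne₁₁ K₀ ψ).symm⟩
  rw [Embeddings.card, hK₀] at h3
  exact lt_irrefl _ h3

/-- **KUDLA–RAPOPORT (2.1) / HOWARD'S `(r, s)`-SIGNATURE CONDITION, VERBATIM ON `Lie(A)` AND FOR EVERY `a ∈ K₀`**:
`char(T, ι(a) | Lie A) = (T − ψ(a))^{m_ψ} (T − ψ̄(a))^{m_ψ̄}` — the complex point `(A, ι|_{K₀})` lies on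
`𝓜(m_ψ, m_ψ̄)` for the embedding `ψ`. [cite: KudlaRapoport2013, §2.1 (2.1)] [cite: Howard2012, §1] -/
theorem charpoly_lieAction_eq_pow_mul_pow (hK₀ : finrank ℚ K₀ = 2) (ψ : K₀ →+* ℂ) (a : K₀) :
    (Motives.AbelianVariety.lieAction A (ιF (algebraMap K₀ F a))).charpoly =
      (X - C (ψ a : ℂ)) ^ Fintype.card {σ : (cmTypeOfPair ιF hF).1 // σ.1.comp (algebraMap K₀ F) = ψ} *
        (X - C (ComplexEmbedding.conjugate ψ a : ℂ)) ^
          Fintype.card {σ : (cmTypeOfPair ιF hF).1 //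
            σ.1.comp (algebraMap K₀ F) = ComplexEmbedding.conjugate ψ} := by
  rw [charpoly_lieAction_eq_prod_pow ιF hF K₀, univ_eq_pair₁₁ K₀ hK₀ ψ, Finset.prod_pair (conjugate_ne₁₁ K₀ _).symm]

/-- **`tr(ι(a) | Lie A) = m_ψ ψ(a) + m_ψ̄ ψ̄(a)`** for every `a ∈ K₀`. [cite: Howard2012, §1] [cite: Shimura1998, §5.2, p. 39] -/
theorem trace_lieAction_eq_card_mul_add_card_mul (hK₀ : finrank ℚ K₀ = 2) (ψ : K₀ →+* ℂ) (a : K₀) :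
    LinearMap.trace ℂ _ (Motives.AbelianVariety.lieAction A (ιF (algebraMap K₀ F a))) =
      (Fintype.card {σ : (cmTypeOfPair ιF hF).1 // σ.1.comp (algebraMap K₀ F) = ψ} : ℂ) * ψ a +
        (Fintype.card {σ : (cmTypeOfPair ιF hF).1 //
          σ.1.comp (algebraMap K₀ F) = ComplexEmbedding.conjugate ψ} : ℂ) * ComplexEmbedding.conjugate ψ a := by
  rw [trace_lieAction_eq_sum ιF hF]
  have h := Fintype.sum_fiberwise' (fun σ : (cmTypeOfPair ιF hF).1 ↦ σ.1.comp (algebraMap K₀ F))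
    (fun χ : K₀ →+* ℂ ↦ (χ a : ℂ))
  simp only [RingHom.comp_apply] at h
  rw [← h, univ_eq_pair₁₁ K₀ hK₀ ψ, Finset.sum_pair (conjugate_ne₁₁ K₀ _).symm, Finset.sum_const, Finset.sum_const,
    Finset.card_univ, Finset.card_univ, nsmul_eq_mul, nsmul_eq_mul]

/-- **The `(r, s)`-signature condition on `Lie(A)` (all `a ∈ K₀`) ⟺ `(m_ψ, m_ψ̄) = (r, s)`.**
[cite: KudlaRapoport2013, §2.1 (2.1)] [cite: Howard2012, §1] [cite: Kottwitz1992, §5 (p. 390)] -/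
theorem forall_charpoly_lieAction_eq_iff_card_fibre_eq (hK₀ : finrank ℚ K₀ = 2) (ψ : K₀ →+* ℂ) (r s : ℕ) :
    (∀ a : K₀, (Motives.AbelianVariety.lieAction A (ιF (algebraMap K₀ F a))).charpoly =
      (X - C (ψ a : ℂ)) ^ r * (X - C (ComplexEmbedding.conjugate ψ a : ℂ)) ^ s) ↔
    Fintype.card {σ : (cmTypeOfPair ιF hF).1 // σ.1.comp (algebraMap K₀ F) = ψ} = r ∧
      Fintype.card {σ : (cmTypeOfPair ιF hF).1 //
        σ.1.comp (algebraMap K₀ F) = ComplexEmbedding.conjugate ψ} = s := by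
  constructor
  · intro h
    refine card_fibre_eq_of_charpoly_eq ιF hF K₀ hK₀ ψ fun a u hu => ?_
    rw [charpoly_cotangentMap_eq_charpoly_lieAction ιF hu]
    exact h a
  · rintro ⟨hr, hs⟩ a
    rw [charpoly_lieAction_eq_pow_mul_pow ιF hF K₀ hK₀ ψ a, hr, hs]

include hF in
/-- **The printed condition on `Lie(A)` for all `a ∈ K₀` ⟺ the lifted condition on `𝔪_e/𝔪_e²` for the genuine
endomorphisms of the order `ι⁻¹(End A) ∩ K₀`** (`EndomorphismFieldSignatureCondition`). [cite: Howard2012, §1]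
[cite: Shimura1998, §3.2] -/
theorem forall_charpoly_lieAction_eq_iff_forall_charpoly_cotangentMap_eq (hK₀ : finrank ℚ K₀ = 2) (ψ : K₀ →+* ℂ)
    (r s : ℕ) :
    (∀ a : K₀, (Motives.AbelianVariety.lieAction A (ιF (algebraMap K₀ F a))).charpoly =
      (X - C (ψ a : ℂ)) ^ r * (X - C (ComplexEmbedding.conjugate ψ a : ℂ)) ^ s) ↔
    ∀ (a : K₀) (u : End A), AbelianVariety.endAlgebra.of A u = ιF (algebraMap K₀ F a) →
      (Motives.AbelianVariety.cotangentMap A u).charpoly =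
        (X - C (ψ a : ℂ)) ^ r * (X - C (ComplexEmbedding.conjugate ψ a : ℂ)) ^ s :=
  (forall_charpoly_lieAction_eq_iff_card_fibre_eq ιF hF K₀ hK₀ ψ r s).trans
    (forall_charpoly_eq_iff_card_fibre_eq ιF hF K₀ hK₀ ψ r s).symm

/-- **The trace condition on `Lie(A)` (all `a ∈ K₀`) ⟺ `(m_ψ, m_ψ̄) = (r, s)`.** [cite: Kottwitz1992, §5 (p. 390)]
[cite: Howard2012, §1] -/
theorem forall_trace_lieAction_eq_iff_card_fibre_eq (hK₀ : finrank ℚ K₀ = 2) (ψ : K₀ →+* ℂ) (r s : ℕ) :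
    (∀ a : K₀, LinearMap.trace ℂ _ (Motives.AbelianVariety.lieAction A (ιF (algebraMap K₀ F a))) =
      (r : ℂ) * ψ a + (s : ℂ) * ComplexEmbedding.conjugate ψ a) ↔
    Fintype.card {σ : (cmTypeOfPair ιF hF).1 // σ.1.comp (algebraMap K₀ F) = ψ} = r ∧
      Fintype.card {σ : (cmTypeOfPair ιF hF).1 //
        σ.1.comp (algebraMap K₀ F) = ComplexEmbedding.conjugate ψ} = s := by
  constructor
  · intro h
    refine card_fibre_eq_of_trace_eq ιF hF K₀ hK₀ ψ fun a u hu => ?_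
    rw [trace_cotangentMap_eq_trace_lieAction ιF hu]
    exact h a
  · rintro ⟨hr, hs⟩ a
    rw [trace_lieAction_eq_card_mul_add_card_mul ιF hF K₀ hK₀ ψ a, hr, hs]

/-! ### §4 The `(1, n − 1)` points: the Hodge conjecture for all powers -/

variable (h3 : 3 ≤ A.dim)
include h3

include hF in
/-- **THE HODGE CONJECTURE FOR EVERY POWER OF A COMPLEX POINT OF `𝓜_{(1, n−1)}` WITH COMPLEX MULTIPLICATION BY
`F ⊇ K₀`** (`n = dim A ≥ 3`), the signature condition being read VERBATIM on `Lie(A)` for all `a ∈ K₀`: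
`char(ι(a) | Lie A) = (X − ψ(a)) (X − ψ̄(a))^{n−1}`. [cite: Howard2012, §1 and §3.1] [cite: KudlaRapoport2013, §2.1 (2.1)]
[cite: Gordon1999HodgeAVSurvey, Thm. 6.4 and §9.3] [cite: Dodson1984, §3.1.1 Theorem] -/
theorem hodgeConjectureFor_powSucc_of_forall_charpoly_lieAction_eq (hK₀ : finrank ℚ K₀ = 2) (ψ : K₀ →+* ℂ)
    (h : ∀ a : K₀, (Motives.AbelianVariety.lieAction A (ιF (algebraMap K₀ F a))).charpoly =
      (X - C (ψ a : ℂ)) ^ 1 * (X - C (ComplexEmbedding.conjugate ψ a : ℂ)) ^ (A.dim - 1)) (N : ℕ) :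
    HodgeConjectureFor (A.powSucc N).dim (A.powSucc N).X :=
  hodgeConjectureFor_powSucc_of_charpoly_eq ιF hF K₀ h3 hK₀ ψ
    ((forall_charpoly_lieAction_eq_iff_forall_charpoly_cotangentMap_eq ιF hF K₀ hK₀ ψ 1 (A.dim - 1)).1 h) N

include hF in
/-- … such an `A` is simple. [cite: Howard2012, §3.1] [cite: Shimura1998, §8.2 Prop. 26] -/
theorem isSimple_of_forall_charpoly_lieAction_eq (hK₀ : finrank ℚ K₀ = 2) (ψ : K₀ →+* ℂ)
    (h : ∀ a : K₀, (Motives.AbelianVariety.lieAction A (ιF (algebraMap K₀ F a))).charpoly =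
      (X - C (ψ a : ℂ)) ^ 1 * (X - C (ComplexEmbedding.conjugate ψ a : ℂ)) ^ (A.dim - 1)) :
    AbelianVariety.IsSimple A :=
  isSimple_of_charpoly_eq ιF hF K₀ h3 hK₀ ψ
    ((forall_charpoly_lieAction_eq_iff_forall_charpoly_cotangentMap_eq ιF hF K₀ hK₀ ψ 1 (A.dim - 1)).1 h)

end Quadratic

end EndFieldFullDegree

end Literature.AlgebraicGeometry.ComplexMultiplication

end
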